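import Summits.Ventures.Crystal3D.Theorems.StickyWulffConstantTextureLiminfTexShadowSplitDefs
import Literature.MathematicalPhysics.StatisticalMechanics.BarlowBilayers
import HarnessLib

/-!
# TB-1/TB-D: every moved Barlow stacking HAS bilayer frames (`BilayerFramesAt` is inhabited)
# (lane T, crux `TextureLiminfV5`, stmt-Ventures-23912; design memo TB-D-0 §2 (texture frames) / the `hA₁, hA₂` fields of `WallCell`)

HONEST FRAMING. Venture `Summits/Ventures/Crystal3D` (cell `crystal3d-full`), route `route-Ventures-StickyWulffConstant`, helper `--supports` the
law-v5 crux `TextureLiminfV5` (stmt-Ventures-23912).  A packaging lemma (census-free, standard axioms): the Literature fact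
`exists_isometry_barlowBilayer_subset_fcc` («every bilayer of a Barlow stacking is an fcc bilayer up to a rigid motion — identity or basal mirror»,
Literature …BarlowBilayers) transported to the route's MOVED stackings `stacking L s σ` and its `bilayer L s σ i`.  Nothing else; F-C1 not moved.

WHY.  Every consumer of the cover interface needs bilayer frames: the wall cell's fields `WallCell.hA₁ / hA₂` (…TextureBuildCoverPieces), the tent
certificate `BarlowFreeCertificate`'s frame table `A`, the texture's slab-grain frames (TB-D-0 §2), and every `BilayerFramesAt` hypothesis of the
TexShadow glue files.  The tree only ever ASSUMED `BilayerFramesAt L s σ A u`; this file PROVIDES it: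
* `bilayer_eq_image_layers` — `bilayer L s σ i = (r ↦ L r + s) '' (barlowLayer i ∪ barlowLayer (i+1))`;
* `exists_frame_bilayer_subset` — per bilayer: `∃ A u, bilayer L s σ i ⊆ (r ↦ A r + u) '' fccRef`;
* **`exists_bilayerFramesAt`** — `IsHaggSeq σ → ∃ A u, BilayerFramesAt L s σ A u` (choice over `i`);
* `exists_bilayerFrames` — the same in the `∀ i, ∃ u` shape of `WallCell.hA₁` / `BarlowFreeCertificate`.
-/

noncomputable section

open scoped BigOperators InnerProductSpace

namespace Summit.Ventures.Crystal3D.Cruxes.TextureLiminf.TexShadow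

open Summit.Ventures.Crystal3D
open Literature.MathematicalPhysics.StatisticalMechanics

/-- The route's `bilayer i` of a moved stacking is the moved union of layers `i` and `i + 1`. -/
theorem bilayer_eq_image_layers (L : E3 ≃ₗᵢ[ℝ] E3) (s : E3) (σ : ℤ → ℤ) (i : ℤ) :
    bilayer L s σ i = (fun r => L r + s) ''
      (barlowLayer 1 (Real.sqrt (2 / 3)) σ i ∪ barlowLayer 1 (Real.sqrt (2 / 3)) σ (i + 1)) := by
  have hpos : 0 < Real.sqrt (2 / 3) := Real.sqrt_pos.2 (by norm_num)
  unfold bilayer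
  congr 1
  ext r
  simp only [Set.mem_setOf_eq, Set.mem_union, barlowLayer]
  constructor
  · rintro ⟨⟨k, a, b, rfl⟩, hk⟩
    rw [barlowPos_apply_two] at hk
    rcases hk with hk | hk
    · left
      have : (k : ℝ) = i := by
        have h := mul_right_cancel₀ hpos.ne' hk
        exact_mod_cast h
      have hki : k = i := by exact_mod_cast this
      exact ⟨a, b, by rw [hki]⟩
    · right
      have : (k : ℝ) = (i : ℝ) + 1 := by
        have h := mul_right_cancel₀ hpos.ne' hk
        exact_mod_cast h
      have hki : k = i + 1 := by exact_mod_cast this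
      exact ⟨a, b, by rw [hki]⟩
  · rintro (⟨a, b, rfl⟩ | ⟨a, b, rfl⟩)
    · exact ⟨barlowPos_mem i a b, Or.inl (by rw [barlowPos_apply_two])⟩
    · exact ⟨barlowPos_mem (i + 1) a b, Or.inr (by rw [barlowPos_apply_two]; push_cast; ring)⟩

/-- **Each bilayer of a moved Barlow stacking lies on a moved fcc lattice.** -/
theorem exists_frame_bilayer_subset {σ : ℤ → ℤ} (hσ : IsHaggSeq σ) (L : E3 ≃ₗᵢ[ℝ] E3) (s : E3) (i : ℤ) :
    ∃ (A : E3 ≃ₗᵢ[ℝ] E3) (u : E3), bilayer L s σ i ⊆ (fun r => A r + u) '' fccRef := by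
  obtain ⟨A₀, u₀, h⟩ := exists_isometry_barlowBilayer_subset_fcc 1 (Real.sqrt (2 / 3)) hσ i
  refine ⟨A₀.trans L, L u₀ + s, ?_⟩
  rw [bilayer_eq_image_layers]
  rintro _ ⟨r, hr, rfl⟩
  obtain ⟨q, hq, hqr⟩ := h hr
  refine ⟨q, hq, ?_⟩
  simp only [LinearIsometryEquiv.coe_trans, Function.comp_apply]
  rw [← hqr, map_add]
  abel

/-- **`BilayerFramesAt` is inhabited**: every moved Barlow stacking with a Hägg word has a table of bilayer frames with origins. -/
theorem exists_bilayerFramesAt {σ : ℤ → ℤ} (hσ : IsHaggSeq σ) (L : E3 ≃ₗᵢ[ℝ] E3) (s : E3) :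
    ∃ (A : ℤ → (E3 ≃ₗᵢ[ℝ] E3)) (u : ℤ → E3), BilayerFramesAt L s σ A u := by
  choose A u h using fun i => exists_frame_bilayer_subset hσ L s i
  exact ⟨A, u, h⟩

/-- The same in the `∀ i, ∃ u` shape consumed by `WallCell.hA₁ / hA₂` and by `BarlowFreeCertificate`. -/
theorem exists_bilayerFrames {σ : ℤ → ℤ} (hσ : IsHaggSeq σ) (L : E3 ≃ₗᵢ[ℝ] E3) (s : E3) :
    ∃ A : ℤ → (E3 ≃ₗᵢ[ℝ] E3), ∀ i, ∃ u : E3, bilayer L s σ i ⊆ (fun r => A i r + u) '' fccRef := by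
  obtain ⟨A, u, h⟩ := exists_bilayerFramesAt hσ L s
  exact ⟨A, fun i => ⟨u i, h i⟩⟩

end Summit.Ventures.Crystal3D.Cruxes.TextureLiminf.TexShadow

end
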